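import Summits.AnomalousDissipation.AnomalousDissipation.Theorems.SolenoidalFractalHomogenisationLagrangianStepVmodConstMode
import HarnessLib

/-!
# K1L_D (stmt-AnomalousDissipation-27980): (V_mod) FLAT STAGE — POINTWISE forms of the three landed text-level reductions
(helper, prover ad-k1loc-p3 g9, tenure RULING D27-11 (1) «EH twins»; `--supports 27980 --as helper`)

prover ad-sawtooth-k1loc-p1 g14 landed the (ℓ2) reductions at TEXT level — `bssNZ_of_ssMode : SSMode_textE e → BssNZ_textE e` (p707395),
`bss_of_bssNZ : BssNZ_textE e → Bss_textE e` (p707653), `lossFlatW_of_blocksE : CoarseSupp_text → Bss_textE e → … → lossFlatW_of_V_textE e`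
(p706403) — where each text is a closed `∀`-statement whose (V) antecedent is merely passed through.  RULING D27-9/D27-9′ threads ONE MORE
antecedent (the W7 high-label binder `hH`) through the (ss) chain; rather than copy each 100-line proof per binder (referee G89 watch #3: «new
fixed-text flat-stage copies = churn»), these two files state the three reductions ONCE at a FIXED parameter tuple and a numeric output exponent `σ'`
(proof bodies = p1 g14's, verbatim up to `e σ ↦ σ'`):
* `blockBound_slowNZ_of_ssMode_at` : single-pair modewise bound ⇒ `BlockBound … IsSlowNZ IsSlowNZ`;
* `blockBound_slow_of_slowNZ_at`   : `BlockBound … IsSlowNZ IsSlowNZ ⇒ BlockBound … IsSlow IsSlow` (mean conservation);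
* (companion `…VmodFlatBlocksEH`: `lossFlatW_of_blockBounds_at` — (F0) + the four block bounds ⇒ `SlowVectorClauseLossFlatW … σ' (C₁+C₂+C₃+C₄)` —
  the `…EH` texts and their three-line twins).
`sorry`-free; NOT a proof of any block, of `stub_Vmod_of_VR(H)`, of K1L_D or AD; rung F-D1.A0.
-/

set_option linter.dupNamespace false

noncomputable section

namespace Summit.AnomalousDissipation.AnomalousDissipation.Theorems.SolenoidalFractalHomogenisation.LagrangianStep.VmodFlat

open Literature.Analysis Literature.Analysis.FluidPDE Literature.Analysis.FunctionSpaces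
open MeasureTheory Set Filter UnitAddTorus
open scoped ENNReal NNReal InnerProductSpace
open Summit.AnomalousDissipation.AnomalousDissipation.Theorems.SolenoidalFractalHomogenisation.LagrangianStep.CellClauseMod
open Summit.AnomalousDissipation.AnomalousDissipation.Theorems.SolenoidalFractalHomogenisation.LagrangianStep.LossCurrency
open Summit.AnomalousDissipation.AnomalousDissipation.Theorems.SolenoidalFractalHomogenisation.RealisedQuasiStaticCellLaw

/-! ## §1 (ss-mode) ⇒ (ss) on nonzero slow data, pointwise -/

set_option maxHeartbeats 1600000 in
/-- **Pointwise (ss-mode) ⇒ (ss) on nonzero slow data** (the body of `bssNZ_of_ssMode`, p707395, at a FIXED parameter tuple and a numeric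
output exponent `σ'`; every text-level variant — `…E` (p707395), `…EH` below, later binders — is a three-line corollary). -/
theorem blockBound_slowNZ_of_ssMode_at {k : ℕ} (W : LatticeShear.LatticeWord k) (M : ℝ) (hM : 0 < M) {c : ℝ} (hc : 0 < c)
    (Φ : ℝ → Torus.Visc4 (Fin 3) → Torus.Visc4 (Fin 3)) {lo hi Λ β σ' C₁ ν₀ K : ℝ} (hlo : 0 < lo) (hΛ : 1 < Λ) (hK : 0 < K) (hC₁ : 0 ≤ C₁)
    (hmode : ∀ ν, ∀ hν : ν ∈ Set.Ioo 0 ν₀, ∀ n : ℕ, (⌈K / ν⌉₊ : ℝ) ≤ n → ∀ 𝔸 : Torus.Visc4 (Fin 3),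
      Torus.OddSmall 𝔸 (ν * β) → (∃ lam ∈ Set.Icc (1:ℝ) Λ, Torus.NearIso 𝔸 (ν * (lo / lam)) (ν * (hi * lam))) →
      Torus.OddSmall (Φ ν ((1 / ν) • 𝔸)) β → (∃ lam ∈ Set.Icc (1:ℝ) Λ, Torus.NearIso (Φ ν ((1 / ν) • 𝔸)) (lo / lam) (hi * lam)) →
      ∀ Tw > (0:ℝ), ∀ U T : ℝ → ℝ → (V2 →L[ℝ] V2),
        Torus.IsPropagator Tw (cellField W M hM ν hν.1 n) ((1 / (n:ℝ) ^ 2) • 𝔸) U →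
        Torus.IsPropagator Tw (fun _ _ => 0) ((1 / (n:ℝ) ^ 2) • (𝔸 + (c / ν) • Φ ν ((1 / ν) • 𝔸))) T →
      ∀ s t : ℝ, 0 ≤ s → s < t → t ≤ Tw →
      ∀ ℓ ∈ (Torus.freqBall (d := Fin 3) (n / 4)).erase 0, ∀ v : V2, v ∈ Torus.divFreeL2 (Fin 3) →
        (∀ k', k' ≠ ℓ → k' ≠ -ℓ → fc v k' = 0) →
        ‖fc (U s t v - T s t v) ℓ‖
          ≤ (C₁ * (C₁ * (ν ^ σ' + ((⌈K / ν⌉₊ : ℝ) / n) ^ σ') + (min 1 ((M * W.period / ν) / (t - s))) ^ σ'))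
            * dW lo Λ c ν n (t - s) ℓ * ‖fc v ℓ‖) :
    BlockBound W M hM c Φ lo hi Λ β σ' C₁ ν₀ K IsSlowNZ IsSlowNZ := by
  intro ν hν n hn 𝔸 hodd hwin hΦo hΦw Tw hTw U T hU hT s t hs hst htT x ζ hx hζ
  -- the resolution `n ≥ 1` and the slow set
  have hn1 : (1:ℝ) ≤ n := by
    have h1 : (1:ℝ) ≤ ⌈K / ν⌉₊ := by
      have : 0 < K / ν := div_pos hK hν.1
      exact_mod_cast Nat.one_le_iff_ne_zero.2 (Nat.pos_iff_ne_zero.1 (Nat.ceil_pos.2 this))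
    exact h1.trans hn
  have hnpos : 0 < n := by exact_mod_cast (show (0:ℝ) < n by linarith)
  have hn0 : (0:ℝ) < n := by exact_mod_cast hnpos
  set S : Finset (Fin 3 → ℤ) := (Torus.freqBall (d := Fin 3) (n / 4)).erase 0 with hS
  have hLN : 2 * (n / 4) < n := by omega
  -- ellipticity windows of the two members
  obtain ⟨lam, hlam, hA𝔸⟩ := hwin
  obtain ⟨lam', hlam', hΦn⟩ := hΦw
  have hlam0 : 0 < lam := by linarith [hlam.1]
  have hlam'0 : 0 < lam' := by linarith [hlam'.1]
  have hcν : 0 ≤ c / ν := div_nonneg hc.le hν.1.le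
  have hn2 : (0:ℝ) < 1 / (n:ℝ) ^ 2 := by positivity
  have hcell : Torus.NearIso ((1 / (n:ℝ) ^ 2) • 𝔸) ((1 / (n:ℝ) ^ 2) * (ν * (lo / lam))) ((1 / (n:ℝ) ^ 2) * (ν * (hi * lam))) :=
    hA𝔸.smul hn2.le
  have hcell_lo : 0 < (1 / (n:ℝ) ^ 2) * (ν * (lo / lam)) := mul_pos hn2 (mul_pos hν.1 (div_pos hlo hlam0))
  have hcoarse0 : Torus.NearIso ((1 / (n:ℝ) ^ 2) • (𝔸 + (c / ν) • Φ ν ((1 / ν) • 𝔸)))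
      ((1 / (n:ℝ) ^ 2) * (ν * (lo / lam) + (c / ν) * (lo / lam'))) ((1 / (n:ℝ) ^ 2) * (ν * (hi * lam) + (c / ν) * (hi * lam'))) :=
    (hA𝔸.add (hΦn.smul hcν)).smul hn2.le
  -- weaken the lower constant to the uniform `loT`
  have hloT_le : loT lo Λ c ν n ≤ (1 / (n:ℝ) ^ 2) * (ν * (lo / lam) + (c / ν) * (lo / lam')) := by
    unfold loT
    have h1 : lo / Λ ≤ lo / lam := div_le_div_of_nonneg_left hlo.le hlam0 hlam.2
    have h2 : lo / Λ ≤ lo / lam' := div_le_div_of_nonneg_left hlo.le hlam'0 hlam'.2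
    have h3 : (ν + c / ν) * (lo / Λ) ≤ ν * (lo / lam) + (c / ν) * (lo / lam') := by
      have := mul_le_mul_of_nonneg_left h1 hν.1.le
      have := mul_le_mul_of_nonneg_left h2 hcν
      nlinarith
    exact mul_le_mul_of_nonneg_left h3 hn2.le
  have hΛ0 : 0 < Λ := by linarith
  have hloT : 0 < loT lo Λ c ν n := by
    unfold loT
    have hνc : 0 < ν + c / ν := by have := hν.1; positivity
    exact mul_pos hn2 (mul_pos hνc (div_pos hlo hΛ0))
  have hcoarse : Torus.NearIso ((1 / (n:ℝ) ^ 2) • (𝔸 + (c / ν) • Φ ν ((1 / ν) • 𝔸)))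
      (loT lo Λ c ν n) ((1 / (n:ℝ) ^ 2) * (ν * (hi * lam) + (c / ν) * (hi * lam'))) := hcoarse0.mono hloT_le le_rfl
  -- class preservation of the cell member (grid-periodic carrier) and of the coarse member (Fourier multiplier)
  have hbU : MemLp (Torus.stLift (cellField W M hM ν hν.1 n)) ∞ (volume.restrict (Ioo 0 Tw ×ˢ (univ : Set (EuclideanSpace ℝ (Fin 3))))) :=
    memLp_top_stLift_cell _ n Tw
  have hbUdiv : ∀ᵐ τ ∂(volume.restrict (Ioo (0:ℝ) Tw)), Torus.IsWeaklyDivFree (cellField W M hM ν hν.1 n τ) :=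
    ae_of_all _ fun τ => (isDivFree_cell _ n τ).isWeaklyDivFree_holds (isSmooth_cell _ n τ)
  have hgrid : ∀ (j : Fin 3 → Fin n) (τ : ℝ) (y : UnitAddTorus (Fin 3)),
      cellField W M hM ν hν.1 n τ (y + (fun i => ((((j i : ℕ) : ℝ) / n : ℝ) : UnitAddCircle))) = cellField W M hM ν hν.1 n τ y :=
    fun j τ y => by unfold cellField; exact cell_add_grid _ hnpos j τ y
  have hUcl : ∀ (c' : Fin 3 → ℤ) (y : V2), (∀ k', ((∀ i, (n:ℤ) ∣ k' i - c' i) ∨ (∀ i, (n:ℤ) ∣ k' i + c' i)) →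
        mFourierCoeff (EuclideanSpace.complexify ∘ ⇑y) k' = 0) →
      ∀ k', ((∀ i, (n:ℤ) ∣ k' i - c' i) ∨ (∀ i, (n:ℤ) ∣ k' i + c' i)) →
        mFourierCoeff (EuclideanSpace.complexify ∘ ⇑(U s t y)) k' = 0 :=
    fun c' y hy k' hk' => PropagatorSymm.fcoeff_apply_eq_zero_of_classes hU hcell hcell_lo hbU hbUdiv hnpos hgrid c' hs hst.le htT y hy k' hk'
  have hTcl : ∀ (c' : Fin 3 → ℤ) (y : V2), (∀ k', ((∀ i, (n:ℤ) ∣ k' i - c' i) ∨ (∀ i, (n:ℤ) ∣ k' i + c' i)) →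
        mFourierCoeff (EuclideanSpace.complexify ∘ ⇑y) k' = 0) →
      ∀ k', ((∀ i, (n:ℤ) ∣ k' i - c' i) ∨ (∀ i, (n:ℤ) ∣ k' i + c' i)) →
        mFourierCoeff (EuclideanSpace.complexify ∘ ⇑(T s t y)) k' = 0 :=
    fun c' y hy k' hk' => fc_propagator_eq_zero hcoarse hloT (fun _ _ => rfl) hT hs hst.le htT y (hy k' hk')
  -- slow nonzero modes are alone in their class pairs and not self-conjugate
  have halone : ∀ ℓ ∈ S, ∀ k' ∈ S, ((∀ i, (n:ℤ) ∣ k' i - ℓ i) ∨ (∀ i, (n:ℤ) ∣ k' i + ℓ i)) → k' = ℓ ∨ k' = -ℓ :=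
    fun ℓ hℓ k' hk' hpair => FlatWindow.alone_of_lt hLN (Finset.mem_of_mem_erase hℓ) (Finset.mem_of_mem_erase hk') hpair
  have hnsc : ∀ ℓ ∈ S, ¬ (∀ i, (n:ℤ) ∣ ℓ i + ℓ i) :=
    fun ℓ hℓ => FlatWindow.not_selfConj_of_lt hLN (Finset.mem_of_mem_erase hℓ) (Finset.ne_of_mem_erase hℓ)
  -- the modewise bound with `ε_ℓ = η · d_ℓ`
  set η : ℝ := C₁ * (C₁ * (ν ^ σ' + ((⌈K / ν⌉₊ : ℝ) / n) ^ σ') + (min 1 ((M * W.period / ν) / (t - s))) ^ σ') with hη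
  have hP0 : 0 ≤ (M * W.period / ν) / (t - s) :=
    div_nonneg (div_nonneg (mul_nonneg hM.le
      (Summit.AnomalousDissipation.AnomalousDissipation.Theorems.SolenoidalFractalHomogenisation.PermissibleCarrier.period_pos W).le) hν.1.le)
      (by linarith)
  have hη0 : 0 ≤ η := by
    have h1 : 0 ≤ ν ^ σ' := Real.rpow_nonneg hν.1.le _
    have h2 : 0 ≤ ((⌈K / ν⌉₊ : ℝ) / n) ^ σ' := Real.rpow_nonneg (by positivity) _
    have h3 : 0 ≤ (min 1 ((M * W.period / ν) / (t - s))) ^ σ' := Real.rpow_nonneg (le_min zero_le_one hP0) _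
    rw [hη]; exact mul_nonneg hC₁ (by positivity)
  set dd : (Fin 3 → ℤ) → ℝ := fun ℓ => dW lo Λ c ν n (t - s) ℓ with hdd
  have hdd0 : ∀ ℓ, 0 ≤ dd ℓ := fun ℓ => by
    rw [hdd]; unfold dW
    have : Real.exp (-(8 * Real.pi ^ 2 * loT lo Λ c ν n * Torus.freqNormSq ℓ * (t - s))) ≤ 1 := by
      apply Real.exp_le_one_iff.2
      have := Real.pi_pos; have := Torus.freqNormSq_nonneg ℓ; have h2 : 0 ≤ t - s := by linarith
      have : 0 ≤ 8 * Real.pi ^ 2 * loT lo Λ c ν n * Torus.freqNormSq ℓ * (t - s) := by positivity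
      linarith
    linarith
  have hmode' : ∀ ℓ ∈ S, ∀ v : V2, v ∈ Torus.divFreeL2 (Fin 3) →
      (∀ k', k' ≠ ℓ → k' ≠ -ℓ → mFourierCoeff (EuclideanSpace.complexify ∘ ⇑v) k' = 0) →
      ‖mFourierCoeff (EuclideanSpace.complexify ∘ ⇑(U s t v - T s t v)) ℓ‖ ≤ (η * dd ℓ) * ‖mFourierCoeff (EuclideanSpace.complexify ∘ ⇑v) ℓ‖ :=
    fun ℓ hℓ v hv hvs => hmode ν hν n hn 𝔸 hodd ⟨lam, hlam, hA𝔸⟩ hΦo ⟨lam', hlam', hΦn⟩ Tw hTw U T hU hT s t hs hst htT ℓ hℓ v hv hvs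
  have key := PropagatorSymm.abs_inner_sub_le_sqrt_of_modewise S (U s t) (T s t) (fun ℓ => η * dd ℓ) hnpos halone hnsc
    (fun ℓ => mul_nonneg hη0 (hdd0 ℓ)) (fun y => hU.apply_eq_apply_starProjection s t y) (fun y => hT.apply_eq_apply_starProjection s t y)
    hUcl hTcl hmode' dd η hη0 hdd0 (fun ℓ _ => le_rfl) x ζ hx hζ
  -- the weighted sums are dominated by the coarse losses
  have hF : ∑ k' ∈ S, dd k' * ‖mFourierCoeff (EuclideanSpace.complexify ∘ ⇑x) k'‖ ^ 2 ≤ lossFwd (T s t) x :=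
    sum_weight_le_lossFwd hcoarse hloT (fun _ _ => rfl) hT hs hst.le htT S x
  have hA : ∑ k' ∈ S, dd k' * ‖mFourierCoeff (EuclideanSpace.complexify ∘ ⇑ζ) k'‖ ^ 2 ≤ lossAdj (T s t) ζ :=
    sum_weight_le_lossAdj hcoarse hloT hT hs hst.le htT S ζ
  refine key.trans ?_
  have h1 := Real.sqrt_le_sqrt hF
  have h2 := Real.sqrt_le_sqrt hA
  exact mul_le_mul (mul_le_mul_of_nonneg_left h1 hη0) h2 (Real.sqrt_nonneg _) (mul_nonneg hη0 (Real.sqrt_nonneg _))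

/-! ## §2 nonzero slow data ⇒ all slow data, pointwise -/

set_option maxHeartbeats 1600000 in
/-- **Pointwise (ss) on nonzero slow data ⇒ (ss)** (the body of `bss_of_bssNZ`, p707653, at a fixed tuple: the constant mode is fixed by both
members and decouples). -/
theorem blockBound_slow_of_slowNZ_at {k : ℕ} (W : LatticeShear.LatticeWord k) (M : ℝ) (hM : 0 < M) {c : ℝ} (hc : 0 < c)
    (Φ : ℝ → Torus.Visc4 (Fin 3) → Torus.Visc4 (Fin 3)) {lo hi Λ β σ' C₁ ν₀ K : ℝ} (hlo : 0 < lo) (hK : 0 < K) (hC₁ : 0 ≤ C₁)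
    (B : BlockBound W M hM c Φ lo hi Λ β σ' C₁ ν₀ K IsSlowNZ IsSlowNZ) :
    BlockBound W M hM c Φ lo hi Λ β σ' C₁ ν₀ K IsSlow IsSlow := by
  intro ν hν n hn 𝔸 hodd hwin hΦo hΦw Tw hTw U T hU hT s t hs hst htT x ζ hx hζ
  -- member facts
  have hn1 : (1:ℝ) ≤ n := by
    have h1 : (1:ℝ) ≤ ⌈K / ν⌉₊ := by
      have : 0 < K / ν := div_pos hK hν.1
      exact_mod_cast Nat.one_le_iff_ne_zero.2 (Nat.pos_iff_ne_zero.1 (Nat.ceil_pos.2 this))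
    exact h1.trans hn
  have hnpos : 0 < n := by exact_mod_cast (show (0:ℝ) < n by linarith)
  have hLN : 2 * (n / 4) < n := by omega
  obtain ⟨lam, hlam, hA𝔸⟩ := hwin
  obtain ⟨lam', hlam', hΦn⟩ := hΦw
  have hlam0 : 0 < lam := by linarith [hlam.1]
  have hlam'0 : 0 < lam' := by linarith [hlam'.1]
  have hcν : 0 ≤ c / ν := div_nonneg hc.le hν.1.le
  have hn2 : (0:ℝ) < 1 / (n:ℝ) ^ 2 := by positivity
  have hcell : Torus.NearIso ((1 / (n:ℝ) ^ 2) • 𝔸) ((1 / (n:ℝ) ^ 2) * (ν * (lo / lam))) ((1 / (n:ℝ) ^ 2) * (ν * (hi * lam))) :=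
    hA𝔸.smul hn2.le
  have hcell_lo : 0 < (1 / (n:ℝ) ^ 2) * (ν * (lo / lam)) := mul_pos hn2 (mul_pos hν.1 (div_pos hlo hlam0))
  have hcoarse : Torus.NearIso ((1 / (n:ℝ) ^ 2) • (𝔸 + (c / ν) • Φ ν ((1 / ν) • 𝔸)))
      ((1 / (n:ℝ) ^ 2) * (ν * (lo / lam) + (c / ν) * (lo / lam'))) ((1 / (n:ℝ) ^ 2) * (ν * (hi * lam) + (c / ν) * (hi * lam'))) :=
    (hA𝔸.add (hΦn.smul hcν)).smul hn2.le
  have hcoarse_lo : 0 < (1 / (n:ℝ) ^ 2) * (ν * (lo / lam) + (c / ν) * (lo / lam')) := by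
    have h1 : 0 < ν * (lo / lam) := mul_pos hν.1 (div_pos hlo hlam0)
    have h2 : 0 ≤ (c / ν) * (lo / lam') := mul_nonneg hcν (div_pos hlo hlam'0).le
    exact mul_pos hn2 (by linarith)
  have hbU : MemLp (Torus.stLift (cellField W M hM ν hν.1 n)) ∞ (volume.restrict (Ioo 0 Tw ×ˢ (univ : Set (EuclideanSpace ℝ (Fin 3))))) :=
    memLp_top_stLift_cell _ n Tw
  have hbUdiv : ∀ᵐ τ ∂(volume.restrict (Ioo (0:ℝ) Tw)), Torus.IsWeaklyDivFree (cellField W M hM ν hν.1 n τ) :=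
    ae_of_all _ fun τ => (isDivFree_cell _ n τ).isWeaklyDivFree_holds (isSmooth_cell _ n τ)
  have hbT : MemLp (Torus.stLift (fun (_ : ℝ) (_ : UnitAddTorus (Fin 3)) => (0 : EuclideanSpace ℝ (Fin 3)))) ∞
      (volume.restrict (Ioo 0 Tw ×ˢ (univ : Set (EuclideanSpace ℝ (Fin 3))))) := memLp_top_const 0
  have hbTdiv : ∀ᵐ τ ∂(volume.restrict (Ioo (0:ℝ) Tw)),
      Torus.IsWeaklyDivFree ((fun (_ : ℝ) (_ : UnitAddTorus (Fin 3)) => (0 : EuclideanSpace ℝ (Fin 3))) τ) :=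
    ae_of_all _ fun τ θ hθ => by simp
  have hgrid : ∀ (j : Fin 3 → Fin n) (τ : ℝ) (y : UnitAddTorus (Fin 3)),
      cellField W M hM ν hν.1 n τ (y + (fun i => ((((j i : ℕ) : ℝ) / n : ℝ) : UnitAddCircle))) = cellField W M hM ν hν.1 n τ y :=
    fun j τ y => by unfold cellField; exact cell_add_grid _ hnpos j τ y
  have hsupp := coarseSupp Tw _ _ _ hcoarse_lo hcoarse T hT s t hs hst.le htT
  -- the split at the zero mode
  set A0 : Set (Fin 3 → ℤ) := {0} with hA0
  obtain ⟨P0, hP0⟩ := exists_labelProj A0 (fun k' => by rw [hA0]; simp)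
  have hP0on : ∀ y : V2, fc (P0 y) 0 = fc y 0 := fun y => by have h := hP0 y 0; rw [if_pos (by rw [hA0]; simp)] at h; exact h
  have hP0off : ∀ (y : V2) k', k' ≠ 0 → fc (P0 y) k' = 0 := fun y k' hk' => by
    have h := hP0 y k'; rw [if_neg (by rw [hA0]; simpa using hk')] at h; exact h
  set x₀ : V2 := P0 x with hx₀
  set x' : V2 := x - P0 x with hx'
  set ζ₀ : V2 := P0 ζ with hζ₀
  set ζ' : V2 := ζ - P0 ζ with hζ'
  have hxsplit : x = x₀ + x' := by rw [hx₀, hx']; abel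
  have hζsplit : ζ = ζ₀ + ζ' := by rw [hζ₀, hζ']; abel
  have nz_of : ∀ y : V2, IsSlow n y → IsSlowNZ n (y - P0 y) := by
    intro y hy k' hk'
    rw [fc_sub]
    by_cases h0 : k' = 0
    · subst h0; rw [hP0on, sub_self]
    · rw [hP0off y k' h0, sub_zero]
      exact hy k' fun hmem => hk' (Finset.mem_erase.2 ⟨h0, hmem⟩)
  have hx'nz : IsSlowNZ n x' := nz_of x hx
  have hζ'nz : IsSlowNZ n ζ' := nz_of ζ hζ
  have hx'0 : fc x' 0 = 0 := hx'nz 0 (by simp)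
  have hζ'0 : fc ζ' 0 = 0 := hζ'nz 0 (by simp)
  -- the constant parts are fixed by both members
  have hUx₀ : U s t x₀ = x₀ := apply_eq_self_of_supp_zero hcell hcell_lo hbU hbUdiv hU hs hst.le htT x₀ (hP0off x)
  have hTx₀ : T s t x₀ = x₀ := apply_eq_self_of_supp_zero hcoarse hcoarse_lo hbT hbTdiv hT hs hst.le htT x₀ (hP0off x)
  -- the zero mode of `(U−T)x'` vanishes: `x'` has no coefficient on the class pair of `0`
  have hx'class : ∀ k', ((∀ i, (n:ℤ) ∣ k' i - (0 : Fin 3 → ℤ) i) ∨ (∀ i, (n:ℤ) ∣ k' i + (0 : Fin 3 → ℤ) i)) →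
      mFourierCoeff (EuclideanSpace.complexify ∘ ⇑x') k' = 0 := by
    intro k' hk'
    by_cases hmem : k' ∈ (Torus.freqBall (d := Fin 3) (n / 4)).erase 0
    · have hk'ball := Finset.mem_of_mem_erase hmem
      have h0ball : (0 : Fin 3 → ℤ) ∈ Torus.freqBall (d := Fin 3) (n / 4) := by
        rw [Torus.mem_freqBall]; simp [Torus.freqNormSq]
      rcases FlatWindow.alone_of_lt hLN h0ball hk'ball hk' with h | h
      · exact absurd h (Finset.ne_of_mem_erase hmem)
      · exact absurd (by simpa using h) (Finset.ne_of_mem_erase hmem)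
    · exact hx'nz k' hmem
  have hUx'0 : fc (U s t x') 0 = 0 :=
    PropagatorSymm.fcoeff_apply_eq_zero_of_classes hU hcell hcell_lo hbU hbUdiv hnpos hgrid 0 hs hst.le htT x' hx'class 0 (Or.inl fun i => by simp)
  have hTx'0 : fc (T s t x') 0 = 0 := (hsupp x' 0 hx'0).1
  have hdiff0 : fc (U s t x' - T s t x') 0 = 0 := by rw [fc_sub, hUx'0, hTx'0, sub_self]
  -- the pairing reduces to the nonzero parts
  have hpair : ⟪U s t x - T s t x, ζ⟫_ℝ = ⟪U s t x' - T s t x', ζ'⟫_ℝ := by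
    have e1 : U s t x - T s t x = U s t x' - T s t x' := by
      rw [hxsplit, map_add, map_add, hUx₀, hTx₀]; abel
    rw [e1, hζsplit, inner_add_right]
    have hz : ⟪U s t x' - T s t x', ζ₀⟫_ℝ = 0 := by
      refine inner_eq_zero_of_fc_disjoint fun k' => ?_
      by_cases h0 : k' = 0
      · subst h0; exact Or.inl hdiff0
      · exact Or.inr (hP0off ζ k' h0)
    rw [hz, zero_add]
  -- the block on the nonzero parts
  have hB := B ν hν n hn 𝔸 hodd ⟨lam, hlam, hA𝔸⟩ hΦo ⟨lam', hlam', hΦn⟩ Tw hTw U T hU hT s t hs hst htT x' ζ' hx'nz hζ'nz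
  -- losses only grow: `q_T(x') ≤ q_T(x)`, `q*_T(ζ') ≤ q*_T(ζ)`
  have hTc : ∀ y, ‖T s t y‖ ≤ ‖y‖ := hT.norm_le s t
  have hox : ⟪x₀, x'⟫_ℝ = 0 := inner_eq_zero_of_fc_disjoint fun k' => by
    by_cases h0 : k' = 0
    · subst h0; exact Or.inr hx'0
    · exact Or.inl (hP0off x k' h0)
  have hoTx : ⟪T s t x₀, T s t x'⟫_ℝ = 0 := inner_eq_zero_of_fc_disjoint fun k' => by
    by_cases h0 : k' = 0
    · subst h0; exact Or.inr hTx'0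
    · exact Or.inl ((hsupp x₀ k' (hP0off x k' h0)).1)
  have hoζ : ⟪ζ₀, ζ'⟫_ℝ = 0 := inner_eq_zero_of_fc_disjoint fun k' => by
    by_cases h0 : k' = 0
    · subst h0; exact Or.inr hζ'0
    · exact Or.inl (hP0off ζ k' h0)
  have hoAζ : ⟪ContinuousLinearMap.adjoint (T s t) ζ₀, ContinuousLinearMap.adjoint (T s t) ζ'⟫_ℝ = 0 :=
    inner_eq_zero_of_fc_disjoint fun k' => by
      by_cases h0 : k' = 0
      · subst h0; exact Or.inr ((hsupp ζ' 0 hζ'0).2)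
      · exact Or.inl ((hsupp ζ₀ k' (hP0off ζ k' h0)).2)
  have hq : lossFwd (T s t) x' ≤ lossFwd (T s t) x := by
    have hadd : lossFwd (T s t) x = lossFwd (T s t) x₀ + lossFwd (T s t) x' := by
      unfold lossFwd; rw [hxsplit]; exact loss_add_of_orthogonal hox hoTx
    have h0 : 0 ≤ lossFwd (T s t) x₀ := loss_nonneg hTc x₀
    rw [hadd]; linarith
  have hqs : lossAdj (T s t) ζ' ≤ lossAdj (T s t) ζ := by
    have hadd : lossAdj (T s t) ζ = lossAdj (T s t) ζ₀ + lossAdj (T s t) ζ' := by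
      unfold lossAdj; rw [hζsplit]; exact loss_add_of_orthogonal hoζ hoAζ
    have h0 : 0 ≤ lossAdj (T s t) ζ₀ := lossAdj_nonneg hTc ζ₀
    rw [hadd]; linarith
  have hP0' : 0 ≤ (M * W.period / ν) / (t - s) :=
    div_nonneg (div_nonneg (mul_nonneg hM.le
      (Summit.AnomalousDissipation.AnomalousDissipation.Theorems.SolenoidalFractalHomogenisation.PermissibleCarrier.period_pos W).le) hν.1.le)
      (by linarith)
  have hη0 : 0 ≤ C₁ * (C₁ * (ν ^ σ' + ((⌈K / ν⌉₊ : ℝ) / n) ^ σ') + (min 1 ((M * W.period / ν) / (t - s))) ^ σ') := by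
    have h1 : 0 ≤ ν ^ σ' := Real.rpow_nonneg hν.1.le _
    have h2 : 0 ≤ ((⌈K / ν⌉₊ : ℝ) / n) ^ σ' := Real.rpow_nonneg (by positivity) _
    have h3 : 0 ≤ (min 1 ((M * W.period / ν) / (t - s))) ^ σ' := Real.rpow_nonneg (le_min zero_le_one hP0') _
    exact mul_nonneg hC₁ (by positivity)
  rw [hpair]
  refine hB.trans ?_
  exact mul_le_mul (mul_le_mul_of_nonneg_left (Real.sqrt_le_sqrt hq) hη0) (Real.sqrt_le_sqrt hqs) (Real.sqrt_nonneg _)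
    (mul_nonneg hη0 (Real.sqrt_nonneg _))

end Summit.AnomalousDissipation.AnomalousDissipation.Theorems.SolenoidalFractalHomogenisation.LagrangianStep.VmodFlat

end
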